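import Literature.NumberTheory.Automorphic.AdicCompletionDegreeOnePlaceEquiv
import Literature.NumberTheory.Automorphic.FixedDegreeOnePlacesFinite
import Literature.NumberTheory.NumberFields.SplitPrimesGaloisClosure
import Literature.NumberTheory.Automorphic.AdeleBaseChange
import Literature.NumberTheory.Automorphic.AdeleRingTopology
import HarnessLib

/-!
# A quadratic extension of number fields has (infinitely many) split finite places; at such a place `δ² = d` has a square root
# in `F_v`

Topic `NumberTheory/Automorphic`; namespace `Literature.NumberTheory.Automorphic.QuadraticExtension`.  KERNEL ONLY: theorems;
no definition, no named fact, no instance, no `sorry`.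

For number fields `E/F` with a non-trivial `F`-automorphism `c` of `E` (the quadratic case: `E = F(δ)`, `c δ = -δ`) and any
finite set `S₁` of finite places of `F`:

* `inertiaDeg_eq_one_of_prime_absNorm` — a place `w` of `E` of PRIME absolute norm has residue degree one over `F`
  (`N w = (N v)^{f(w|v)}`, Mathlib `Ideal.absNorm_pow_inertiaDeg`);
* **`exists_smul_ne_under_notMem`** — there is a finite place `w` of `E` with `c • w ≠ w` (i.e. `v := w ∩ 𝓞_F` SPLITS in `E`)
  and `v ∉ S₁`: the places of prime absolute norm are infinite (★ `NumberFields.infinite_setOf_prime_absNorm`, the degree-one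
  case of Chebotarev), all but finitely many degree-one places are moved by `c ≠ 1`
  (★ `FixedDegreeOnePlacesFinite.finite_setOf_smul_eq_and_inertiaDeg_eq_one`), and `w ↦ w ∩ 𝓞_F` has finite fibres
  (★ `HeightOneSpectrum.tendsto_under_cofinite`);
* **`exists_split_place`** — hence, if `δ ∈ E` with `δ² = d ∈ F`, there are a finite place `v ∉ S₁` of `F` and `s ∈ F_v` with
  `s² = d`: at a split place `e(w|v) = f(w|v) = 1` (★ `ramificationIdx_eq_one_and_inertiaDeg_eq_one_of_smul_ne`), so
  `F_v ≃+* E_w` (★ `adicCompletionEquivOfDegreeOne`) and `s :=` the preimage of `δ`; and the bare form `exists_split_place'`.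

This is the «choose an auxiliary place `v` of `F` split in `E`» of A. Weil, *Acta Math.* 113 (1965), Chap. V n° 50 p. 72 (proof
of Thm. 4: «prenons une place `v` de `k` … telle que l'algèbre se décompose»), here for the CM quadratic extension of the unitary dual
pair; classical source for the infinitude of split primes: D. Marcus, *Number Fields* (2018), Ch. 4 Exercise 30; J. Neukirch,
*Algebraic Number Theory* (1999), Ch. I §9 (9.4), Ch. VII §13 (13.6).

USE (cell `hodgecm-mathlib`, FLOOR-0 P4, ENGINE E-2, `StubSW2` (iii)): the consumer of ★ `H413E2SWSplitPlaceLetters` ∕ `…SplitPlaceFrame`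
(`hs : s * s = algebraMap F F_v d`) picks `v, s` here.  HC_CM is proved only modulo the printed citations until rung 0 closes.
-/

set_option autoImplicit false

noncomputable section

namespace Literature.NumberTheory.Automorphic.QuadraticExtension

open NumberField IsDedekindDomain Filter Set Ideal

variable (F E : Type) [Field F] [NumberField F] [Field E] [NumberField E] [Algebra F E] [Algebra.IsQuadraticExtension F E]

omit [Algebra.IsQuadraticExtension F E] in
/-- **a place of prime absolute norm has residue degree one over any subfield**: `N(w) = N(v)^{f(w|v)}` with `N(v) > 1`, so a
prime `N(w)` forces `f(w|v) = 1`. [cite: Marcus2018, Ch. 4, Exercise 30 (b)] -/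
theorem inertiaDeg_eq_one_of_prime_absNorm (w : HeightOneSpectrum (𝓞 E)) (hw : (Ideal.absNorm w.asIdeal).Prime) :
    w.asIdeal.inertiaDeg (𝓞 F) = 1 := by
  set v : HeightOneSpectrum (𝓞 F) := w.under (𝓞 F) with hv
  haveI : w.asIdeal.LiesOver v.asIdeal := ⟨rfl⟩
  have hpow : Ideal.absNorm v.asIdeal ^ w.asIdeal.inertiaDeg (𝓞 F) = Ideal.absNorm w.asIdeal :=
    Ideal.absNorm_pow_inertiaDeg v.asIdeal w.asIdeal
  exact ((Nat.Prime.pow_eq_iff hw).mp hpow).2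

omit [Algebra.IsQuadraticExtension F E] in
/-- **a quadratic-type extension has split places outside any finite set**: for `c ≠ 1` in `Aut(E/F)` and a finite set `S₁` of
finite places of `F` there is a finite place `w` of `E` moved by `c` (so `v = w ∩ 𝓞_F` splits in `E`) with `w ∩ 𝓞_F ∉ S₁`.
[cite: NeukirchANT1999, Ch. I §9 (9.4)] [cite: Marcus2018, Ch. 4, Exercise 30 (b)] -/
theorem exists_smul_ne_under_notMem {c : E ≃ₐ[F] E} (hc : c ≠ 1) {S₁ : Set (HeightOneSpectrum (𝓞 F))} (hS₁ : S₁.Finite) :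
    ∃ w : HeightOneSpectrum (𝓞 E), c • w ≠ w ∧ w.under (𝓞 F) ∉ S₁ := by
  -- infinitely many places of prime absolute norm; remove two finite bad sets
  have hinf := Literature.NumberTheory.NumberFields.infinite_setOf_prime_absNorm (K := E)
  have hfix : {w : HeightOneSpectrum (𝓞 E) | c • w = w ∧ w.asIdeal.inertiaDeg (𝓞 F) = 1}.Finite :=
    finite_setOf_smul_eq_and_inertiaDeg_eq_one F hc
  have hunder : {w : HeightOneSpectrum (𝓞 E) | w.under (𝓞 F) ∈ S₁}.Finite := by
    have h1 : ∀ᶠ v : HeightOneSpectrum (𝓞 F) in cofinite, v ∉ S₁ := by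
      rw [eventually_cofinite]
      exact hS₁.subset fun v hv => not_not.mp hv
    have h2 : ∀ᶠ w : HeightOneSpectrum (𝓞 E) in cofinite, w.under (𝓞 F) ∉ S₁ :=
      (HeightOneSpectrum.tendsto_under_cofinite (𝓞 F) (B := 𝓞 E)).eventually h1
    rw [eventually_cofinite] at h2
    exact h2.subset fun w hw => not_not.mpr hw
  obtain ⟨w, ⟨hwP, hwfix⟩, hwS⟩ := ((hinf.sdiff hfix).sdiff hunder).nonempty
  refine ⟨w, fun heq => hwfix ⟨heq, inertiaDeg_eq_one_of_prime_absNorm F E w hwP⟩, fun hmem => hwS hmem⟩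

variable {F E}

omit [NumberField F] [Algebra.IsQuadraticExtension F E] in
/-- `c ≠ 1` for an automorphism with `c δ = -δ`, `δ ≠ 0` (characteristic zero). [folklore] -/
private theorem ne_one_of_apply_eq_neg {c : E ≃ₐ[F] E} {δ : E} (hcδ : c δ = -δ) (hδ : δ ≠ 0) : c ≠ 1 := by
  rintro rfl
  rw [AlgEquiv.one_apply] at hcδ
  have h2 : (2 : E) * δ = 0 := by linear_combination hcδ
  exact hδ ((mul_eq_zero.mp h2).resolve_left two_ne_zero)

variable (F E)

/-- **THE AUXILIARY SPLIT PLACE**: for `E = F(δ)` with `c δ = -δ ≠ 0`, `δ² = d ∈ F`, and any finite set `S₁` of finite places of `F`,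
there are a finite place `v ∉ S₁` of `F` and `s ∈ F_v` with `s² = d` — indeed `v := w ∩ 𝓞_F` for a place `w` of `E` moved by `c`,
so `e(w|v) = f(w|v) = 1`, `F_v ≃+* E_w` (★ `adicCompletionEquivOfDegreeOne`), and `s` is the preimage of `δ`.  Weil's choice of an
auxiliary place at which the algebra «se décompose». [cite: Weil1965, Chap. V n° 50, p. 72] [cite: NeukirchANT1999, Ch. I §9 (9.4)] -/
theorem exists_split_place (c : E ≃ₐ[F] E) {δ : E} (hcδ : c δ = -δ) (hδ : δ ≠ 0) {d : F} (hd : δ * δ = algebraMap F E d)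
    {S₁ : Set (HeightOneSpectrum (𝓞 F))} (hS₁ : S₁.Finite) :
    ∃ v : HeightOneSpectrum (𝓞 F), v ∉ S₁ ∧ ∃ s : v.adicCompletion F, s * s = algebraMap F (v.adicCompletion F) d := by
  obtain ⟨w, hw, hwS⟩ := exists_smul_ne_under_notMem F E (ne_one_of_apply_eq_neg hcδ hδ) hS₁
  set v : HeightOneSpectrum (𝓞 F) := w.under (𝓞 F) with hv
  haveI : w.asIdeal.LiesOver v.asIdeal := ⟨rfl⟩
  obtain ⟨he, hf⟩ := ramificationIdx_eq_one_and_inertiaDeg_eq_one_of_smul_ne (F := F) c hw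
  let φ := adicCompletionEquivOfDegreeOne F E v w he hf
  refine ⟨v, hwS, φ.symm (algebraMap E (w.adicCompletion E) δ), φ.injective ?_⟩
  rw [map_mul, RingEquiv.apply_symm_apply, ← map_mul, hd, ← adicCompletion_coe_eq_algebraMap (𝓞 F) F v d,
    adicCompletionEquivOfDegreeOne_coe F E v w he hf d, adicCompletion_coe_eq_algebraMap (𝓞 E) E w]

/-- **bare form**: a finite place `v` of `F` and `s ∈ F_v` with `s² = d`. [cite: Weil1965, Chap. V n° 50, p. 72] -/
theorem exists_split_place' (c : E ≃ₐ[F] E) {δ : E} (hcδ : c δ = -δ) (hδ : δ ≠ 0) {d : F} (hd : δ * δ = algebraMap F E d) :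
    ∃ (v : HeightOneSpectrum (𝓞 F)) (s : v.adicCompletion F), s * s = algebraMap F (v.adicCompletion F) d := by
  obtain ⟨v, -, s, hs⟩ := exists_split_place F E c hcδ hδ hd Set.finite_empty
  exact ⟨v, s, hs⟩

end Literature.NumberTheory.Automorphic.QuadraticExtension
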